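import Literature.AlgebraicTopology.SingularHomology.LocalHomologyOfSetTransfer
import Literature.AlgebraicTopology.SingularHomology.RelativeHomotopyInvariance
import HarnessLib

/-!
# A self-map acts trivially on local homology at a fixed point when it is locally conjugate to a map homotopic to the identity

Family `hodge`, layer `Literature/AlgebraicTopology/SingularHomology`. The local-degree computation
used for the orientation behaviour of finite-order automorphisms of complex manifolds (applied in
`Literature/AlgebraicGeometry/HodgeTheory/FermatRotationDegree` to the coordinate rotations of the
Fermat hypersurfaces): Hatcher, *Algebraic Topology* (2002), §2.2 "local degree" (Prop. 2.30 and
the discussion p. 136) and §3.3 p. 231/233 (local homology only depends on a neighbourhood,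
excision), together with homotopy invariance for pairs (Prop. 2.19 / Ex. 2.27).

Everything PROVED (no named facts):

* `relativeSingularHomology.map_eq_id_of_conj_isOpenEmbedding` — let `e : X → X` be continuous
  with `e(X ∖ {P}) ⊆ X ∖ {P}`, and let `κ : D → X` be an open embedding with `κ d₀ = P`
  intertwining `e` with a self-map `L` of `D` (`e ∘ κ = κ ∘ L`) which maps `D ∖ {d₀}` into
  itself and is homotopic to the identity through such maps. Then
  `e_* = 𝟙` on the local homology `H_q(X | P; M) = H_q(X, X ∖ {P}; M)` (`P` closed).
  Proof: excision `H_q(range κ | P) ≅ H_q(X | P)` (`isIso_map_subsetIncl_of_isClosed`), the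
  homeomorphism `D ≃ₜ range κ`, and `L_* = 𝟙_* ` by homotopy invariance of pairs
  (`relativeSingularHomology.map_eq_of_homotopic_holds`).

## References

* [HatcherAT2002] A. Hatcher, Algebraic Topology, CUP 2002, §2.2 Prop. 2.30, §3.3 p. 233,
  Prop. 2.19.
-/

noncomputable section

open CategoryTheory Set Topology

universe v u

namespace Literature.AlgebraicTopology.SingularHomology

namespace relativeSingularHomology

variable (R : Type v) [CommRing R] (M : Type v) [AddCommGroup M] [Module R M]
variable {X : Type u} [TopologicalSpace X] {D : Type u} [TopologicalSpace D]

/-- The restriction of a self-map `e` of `X` to an `e`-stable subset `Ω`, as a continuous self-map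
of `Ω`. [folklore] -/
def restrictSelf (e : C(X, X)) (Ω : Set X) (hΩ : MapsTo e Ω Ω) : C(Ω, Ω) :=
  ⟨hΩ.restrict e Ω Ω, (e.continuous.comp continuous_subtype_val).subtype_mk _⟩

/-- `restrictSelf` on points. [folklore] -/
@[simp] theorem restrictSelf_apply_coe (e : C(X, X)) (Ω : Set X) (hΩ : MapsTo e Ω Ω) (x : Ω) :
    ((restrictSelf e Ω hΩ x : Ω) : X) = e x := rfl

/-- **A self-map locally conjugate (through an open embedding at a fixed point) to a self-map
homotopic to the identity through maps of the punctured pair acts as the identity on local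
homology** (Hatcher 2002, §2.2 local degree, §3.3 excision, Prop. 2.19 homotopy invariance of
pairs). Hypotheses: `e : X → X` with `e(X ∖ {P}) ⊆ X ∖ {P}`; `κ : D → X` an open embedding,
`κ d₀ = P`, `e ∘ κ = κ ∘ L`; `L(D ∖ {d₀}) ⊆ D ∖ {d₀}`; a homotopy `F` from `id` to `L` with
`F(t, d) ≠ d₀` for `d ≠ d₀`; `{P}` closed. Conclusion: `e_* = 𝟙` on `H_q(X, X ∖ {P}; M)`.
[cite: HatcherAT2002, §2.2 Prop. 2.30] -/
theorem map_eq_id_of_conj_isOpenEmbedding (e : C(X, X)) (P : X) (hP : IsClosed ({P} : Set X))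
    (he : MapsTo e ({P}ᶜ : Set X) ({P}ᶜ : Set X))
    (κ : D → X) (hκ : IsOpenEmbedding κ) (d₀ : D) (hd₀ : κ d₀ = P)
    (L : C(D, D)) (hL : MapsTo L ({d₀}ᶜ : Set D) ({d₀}ᶜ : Set D)) (hconj : ∀ d, e (κ d) = κ (L d))
    (F : ContinuousMap.Homotopy (ContinuousMap.id D) L)
    (hF : ∀ td : unitInterval × D, td.2 ∈ ({d₀}ᶜ : Set D) → F td ∈ ({d₀}ᶜ : Set D)) (q : ℕ) :
    relativeSingularHomology.map R M e he q = 𝟙 (localHomology R M X P q) := by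
  -- (1) `L_* = 𝟙` on `H_q(D, D ∖ {d₀})`
  have hL1 : relativeSingularHomology.map R M L hL q = 𝟙 _ := by
    rw [← relativeSingularHomology.map_eq_of_homotopic_holds R M (mapsTo_id _) hL F hF q,
      relativeSingularHomology.map_id]
  -- (2) the open set `Ω = range κ`, stable under `e`, and the restriction `eΩ`
  set Ω : Set X := range κ with hΩdef
  have hΩo : IsOpen Ω := hκ.isOpen_range
  have heΩ : MapsTo e Ω Ω := by
    rintro _ ⟨d, rfl⟩
    exact ⟨L d, (hconj d).symm⟩
  have hPΩ : P ∈ Ω := ⟨d₀, hd₀⟩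
  let eΩ : C(Ω, Ω) := restrictSelf e Ω heΩ
  have heΩ' : MapsTo eΩ ((Subtype.val ⁻¹' {P} : Set Ω)ᶜ) ((Subtype.val ⁻¹' {P} : Set Ω)ᶜ) := by
    intro x hx h
    exact he hx h
  -- (3) excision: `j : H_q(Ω | P) ≅ H_q(X | P)` and the square `eΩ_* ≫ j = j ≫ e_*`
  haveI hj := localHomologyOfSet.isIso_map_subsetIncl_of_isClosed R M hΩo hP (singleton_subset_iff.2 hPΩ) q
  have hsq1 : relativeSingularHomology.map R M eΩ heΩ' q ≫
      relativeSingularHomology.map R M (subsetIncl Ω) (localHomologyOfSet.mapsTo_val_compl Ω {P}) q =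
      relativeSingularHomology.map R M (subsetIncl Ω) (localHomologyOfSet.mapsTo_val_compl Ω {P}) q ≫
        relativeSingularHomology.map R M e he q := by
    rw [← relativeSingularHomology.map_comp, ← relativeSingularHomology.map_comp]
    rfl
  -- (4) the homeomorphism `h : D ≃ₜ Ω` and the square `L_* ≫ k = k ≫ eΩ_*`
  let h : D ≃ₜ Ω := hκ.isEmbedding.toHomeomorph
  have hh : ∀ d, ((h d : Ω) : X) = κ d := fun d ↦ rfl
  have hk : MapsTo (h : C(D, Ω)) ({d₀}ᶜ : Set D) ((Subtype.val ⁻¹' {P} : Set Ω)ᶜ) := by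
    intro d hd hmem
    apply hd
    have h1 : κ d = P := hmem
    rw [← hd₀] at h1
    exact mem_singleton_iff.2 (hκ.injective h1)
  have hk' : MapsTo (h.symm : C(Ω, D)) ((Subtype.val ⁻¹' {P} : Set Ω)ᶜ) ({d₀}ᶜ : Set D) := by
    intro x hx hmem
    apply hx
    rw [mem_singleton_iff] at hmem
    change (x : X) ∈ ({P} : Set X)
    rw [mem_singleton_iff, ← hd₀, ← hmem, ← hh]
    exact (congrArg Subtype.val (h.apply_symm_apply x)).symm
  have hsq2 : relativeSingularHomology.map R M L hL q ≫ relativeSingularHomology.map R M (h : C(D, Ω)) hk q =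
      relativeSingularHomology.map R M (h : C(D, Ω)) hk q ≫ relativeSingularHomology.map R M eΩ heΩ' q := by
    rw [← relativeSingularHomology.map_comp, ← relativeSingularHomology.map_comp]
    congr 1
    ext d
    exact (hconj d).symm
  -- `k` is an isomorphism (inverse `h.symm`), in particular an epimorphism
  haveI : Epi (relativeSingularHomology.map R M (h : C(D, Ω)) hk q) := by
    haveI : IsIso (relativeSingularHomology.map R M (h : C(D, Ω)) hk q) :=
      ⟨relativeSingularHomology.map R M (h.symm : C(Ω, D)) hk' q, by
        rw [← relativeSingularHomology.map_comp]
        convert relativeSingularHomology.map_id R M ({d₀}ᶜ : Set D) q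
        ext d; exact h.symm_apply_apply d, by
        rw [← relativeSingularHomology.map_comp]
        convert relativeSingularHomology.map_id R M ((Subtype.val ⁻¹' {P} : Set Ω)ᶜ) q
        ext x; exact congrArg Subtype.val (h.apply_symm_apply x)⟩
    infer_instance
  -- (5) conclude: `eΩ_* = 𝟙`, then `e_* = 𝟙`
  have heΩ1 : relativeSingularHomology.map R M eΩ heΩ' q = 𝟙 _ := by
    rw [← cancel_epi (relativeSingularHomology.map R M (h : C(D, Ω)) hk q), ← hsq2, hL1,
      Category.id_comp, Category.comp_id]
  rw [← cancel_epi (relativeSingularHomology.map R M (subsetIncl Ω) (localHomologyOfSet.mapsTo_val_compl Ω {P}) q),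
    ← hsq1, heΩ1, Category.id_comp, Category.comp_id]

end relativeSingularHomology

end Literature.AlgebraicTopology.SingularHomology

end
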